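import Literature.Probability.RandomPlanarGeometry.SAWFiniteMemory
import HarnessLib

/-!
# `μ(ℤ²) ≤ 2.695`: the memory-16 Pönitz–Tittmann certificate (one `native_decide`)

Topic `Literature/Probability/RandomPlanarGeometry`. One compiled evaluation of
`FiniteMemory.check 16 2695 1000 50` (`SAWFiniteMemory.lean`): the breadth-first search finds the
467 249 states of the memory-16 automaton of Pönitz–Tittmann (2000) on `ℤ²`, 50 rounds of integer
power iteration propose a weight vector, and the verified checker confirms closure and the
Collatz–Wielandt inequalities with ratio `2695/1000` (the Perron root is `2.693849…`, P–T Table 2,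
`k = 16`: `2.6939`). By `connectiveConstant_le_of_check` this proves **`μ(ℤ²) ≤ 2.695`**, hence the
upper half `μ ≤ 2.7` of the bounds quoted by Lawler–Schramm–Werner (2004), §3.1. The only
non-standard axiom is the `native_decide` auxiliary axiom of `check_16` (trust in the Lean compiler,
`Lean.ofReduceBool`), declared to the gate as `computational`. Memory 14 would not suffice
(`λ = 2.7014 > 2.7`); the evaluation takes ≈ 3 minutes.

## References

* A. Pönitz, P. Tittmann, *Improved upper bounds for self-avoiding walks in ℤᵈ*, Electron. J.
  Combin. 7 (2000) R21, Table 2.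
* G. F. Lawler, O. Schramm, W. Werner, *On the scaling limit of planar self-avoiding walk* (2004), §3.1.
-/

namespace Literature.Probability.RandomPlanarGeometry.SAW

/-- The memory-16 certificate evaluates to `true` (467 249 states, ratio `2.695`).
[cite: PonitzTittmann2000, Table 2] -/
theorem FiniteMemory.check_16 : FiniteMemory.check 16 2695 1000 50 = true := by
  native_decide

/-- **`μ(ℤ²) ≤ 2.695`** (Pönitz–Tittmann 2000, Table 2, `k = 16`: `μ ≤ 2.6939`).
[cite: PonitzTittmann2000, Table 2] -/
theorem connectiveConstant_le_2695 : connectiveConstant ≤ 2.695 := by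
  have h := FiniteMemory.connectiveConstant_le_of_check FiniteMemory.check_16 (by norm_num)
  have e : ((2695 : ℕ) : ℝ) / ((1000 : ℕ) : ℝ) = 2.695 := by norm_num
  rwa [e] at h

/-- **`μ(ℤ²) ≤ 2.7`**, the upper half of "rigorously it is known to be between 2.6 and 2.7".
[cite: LawlerSchrammWerner2004SAW, §3.1] -/
theorem connectiveConstant_le_27 : connectiveConstant ≤ 2.7 :=
  connectiveConstant_le_2695.trans (by norm_num)

end Literature.Probability.RandomPlanarGeometry.SAW
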